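import Mathlib
import HarnessLib
import HarnessLib.Audit
import Summits.Schanuel.Statement
import HarnessLib.Audit.Status.Attr

/-!
Route: DilateIntersection

DORMANT since 2026-08-22T14:15:06Z (reconciler: no traction for 5.4 d (last activity item-evidence-added at 2026-08-17T04:13:05Z); parked, not closed — `ledger route dormant route-Schanuel-DilateIntersection --off` to reactivate) — unstaffed, not closed; items shared with open routes are served there. `ledger route dormant <id> --off` reactivates.

# Route DilateIntersection — grid theorems as forbidden configurations — the density ladder (√N, ½)
below rank ≤ trdeg for exponential points

It suffices to show X = RankLeTrdeg (SHARED verbatim with route ExpMordellWeil): for every subfield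
K ⊂ ℂ, every
ℚ-linearly independent family u₁,…,uₙ of exponential points of K (uᵢ ∈ K and e^{uᵢ} ∈ K) has n ≤
trdeg_ℚ K; X → Schanuel
with K := ℚ(z, e^z) (Assembly, kernel-checked in Sketch.lean) and Schanuel → X by monotonicity, so X
⟺ Schanuel and this
route, like ExpMordellWeil, is a LADDER below X — but a different one, realising card
dilate-intersection-exponential-points:
read the T.H.-free grid theorems (six exponentials; NesterenkoPhilippon2001 Ch.14 Thm 2.9, the 2×3
"+x+y" clause) as
FORBIDDEN CONFIGURATIONS (K₂,₃) in the incidence structure "u ↦ e^u ∈ L" and let extremal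
combinatorics count. At
trdeg L = 1 this gives, unconditionally modulo the printed Thm 2.9, the dilate-intersection lemma
(no three independent
y with y, e^y, e^{uy} ∈ L, u ∈ L∖ℚ), hence |{s ≤ N : e^{θ^s} ∈ L}| ≤ 2√N + 2 for every
transcendental θ ∈ L and rank ≤
D/2 + 2 for polynomial exponents of degree ≤ D — where X says 1. The staffed cruxes are the first
statements BEYOND
these shadows (o(√N); density < ½; at most one power), which the card's calibration shows no grid
theorem or grid
CONJECTURE (K₂,₂ = four exponentials) can reach: they are the cheapest certified detectors of
genuinely new input.
Lean: `∀ (K : IntermediateField ℚ ℂ) (n : ℕ) (u : Fin n → ℂ), (∀ i, u i ∈ K ∧ Complex.exp (u i) ∈ K)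
→ LinearIndependent ℚ u → (n : Cardinal) ≤ Algebra.trdeg ℚ K`

## Assembly
Bookkeeping, identical to ExpMordellWeil's assembly (shared item): given z : Fin n → ℂ ℚ-linearly
independent take
K := IntermediateField.adjoin ℚ (range z ∪ range (exp ∘ z)) and u := z; X gives n ≤ trdeg_ℚ K, which
is
Literature.Periods.SchanuelConjecture unfolded. Kernel-checked in Sketch.lean (assembly_holds). The
cruxes are rungs
strictly below X (LadderBookkeeping), not factors of it: this is a ladder route.

Rationale: WHY THIS LINE. Mechanism (card dilate-intersection-exponential-points, triaged new-combination): a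
2×3 grid x = (1,u), y = (y₁,y₂,y₃) with
x, y and all e^{xᵢyⱼ} inside a field L of transcendence degree 1 contradicts NesterenkoPhilippon2001
Ch.14 Thm 2.9
(t₂ ≥ 2 for dℓ > d+ℓ; BakerTNT1975 Ch.12, Tijdeman's 3×2 variant p.111), so the exponential points W
of L meet each
dilate uW (u ∈ L∖ℚ) in dimension ≤ 2; with u = θᵏ this says every positive difference occurs at most
twice in the
power spectrum S_θ(L) = {s : e^{θ^s} ∈ L}, and double counting (the Kővári–Sós–Turán argument,
Jukna2011 Thm 2.4)
gives |S_θ ∩ [0,N]| ≤ 2√N + 2 with an absolute constant; linear algebra of P ∩ θP gives half density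
for polynomial
exponents; six exponentials (tree theorem six_exponentials_holds) as "K₂,₃-free" gives O(N^{3/2})
algebraic values
e^{xᵢyⱼ} among N². Imported area: extremal graph theory / additive combinatorics (Zarankiewicz
counting, Sidon
calibration) applied to the incidence structure of exponential points — not used on this summit
before (searched, see
Novelty). What it adds to ExpMordellWeil (finiteness FG via E-derivations) and AlgIndepMethod (the
Gel'fond–Diaz
ladder on full grids): the first UNCONDITIONAL sparsity theorems toward FG/UniformRankBound on
structured parts of
Γ(K) ("FG in density"), and a calibration locating exactly where grid input stops (K₂,₃ theorem →
K₂,₂ four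
exponentials → K₁,₂ = X itself; shadows N^{3/2}, √N, then 1), so the cruxes below are certified
grid-invisible.

RANKED CRUXES. #0 RankLeTrdeg (target) — X (shared with ExpMordellWeil.RankLeTrdeg): exponential
points of any subfield K ⊂ ℂ have ℚ-rank ≤ trdeg_ℚ K. (why it might fail: Iff Schanuel fails; at
trdeg 1 it already contains e ⊥ π and e^{π²} ∉ ℚ̄(π); it is the K₁,₂ (one-row) statement no grid
method sees.) [MantovaZannier2016, Marker2006, Waldschmidt2000, NesterenkoPhilippon2001]
#2 PowerSpectrumAtMostOne (crux) — Schanuel's value for power spectra (card X/T4): if L ⊂ ℂ has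
trdeg_ℚ L ≤ 1 and θ ∈ L is transcendental, then e^{θ^s} ∈ L for at most one s ∈ ℕ. Instances:
e^{e^s} ∉ ℚ̄(e) for all s ≥ 1 (none known); at most one of e, e^{π²}, e^{π³}, … lies in ℚ̄(π) (e^{π}
excluded by Nesterenko); structured slice of Schanuel n = 2 (pairs (θ^s, θ^t)). [difficulty:
open-problem] (why it might fail: False only with Schanuel n=2 on a power pair; as a rung it is K₁,₂
(one row, two exponentials in a trdeg-1 field): dℓ > d+ℓ fails for d = 1, so no grid theorem and not
even Conj 2.3 / four exponentials reaches it — needs a relative Hermite–Lindemann nobody has.)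
[NesterenkoPhilippon2001, BakerTNT1975, Waldschmidt2004, Chudnovsky1984,
idea:Schanuel/Schanuel/dilate-intersection-exponential-points]
#3 SubSqrtPowerSpectrum (crux) — the detector (card C2): a uniform o(√N) bound for power spectra of
transcendence-degree-one fields — for every ε > 0 and N ≥ N₀(ε), every L with trdeg_ℚ L ≤ 1 and
every transcendental θ ∈ L have #{s ≤ N : e^{θ^s} ∈ L} ≤ ε√N. Known: ≤ 2√N + 2 (support
PowerSpectrumSqrtBound); Schanuel: ≤ 1. [difficulty: open-problem] (why it might fail: True under
Schanuel; but Sidon sets have ≍√N elements and are K₂,₂-free, so even an in-field four-exponentials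
theorem leaves √N: any proof must extract trdeg 2 from ONE row (a K₁,ₘ configuration), which no
transcendence method does — the statement may be exactly as hard as rank 2.)
[NesterenkoPhilippon2001, Jukna2011, doi:10.1112/jlms/s1-16.4.212,
idea:Schanuel/Schanuel/dilate-intersection-exponential-points]
#4 SubHalfDensity (crux) — beat half density for polynomial exponents (card B₀ ↦ its first
improvement): there are c < 1/2 and C such that for every L with trdeg_ℚ L ≤ 1, transcendental θ ∈ L
and ℚ-linearly independent p₁,…,p_m ∈ ℚ[X] of degree ≤ D with all e^{pᵢ(θ)} ∈ L, m ≤ cD + C. Known: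
2m ≤ D + 4 (support HalfDensityBound); Schanuel: m ≤ 1. The density twin of the Gel'fond–Diaz "half"
(AlgIndepMethod crux GelfondDiazLadderFull). [difficulty: open-problem] (why it might fail: True
under Schanuel; but a generic half-dimensional subspace P ⊂ ℚ[θ]_{≤D} meets none of its dilates θᵏP
in dimension ≥ 3, so dilate/grid input ends exactly at ½ (cf. Diaz's ⌊(d+1)/2⌋ on Gel'fond's ladder,
35 years at 'half'); crossing ½ needs non-product information.) [NesterenkoPhilippon2001, Diaz1989,
Chudnovsky1984, idea:Schanuel/Schanuel/grid-capacity-half-schanuel,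
idea:Schanuel/Schanuel/dilate-intersection-exponential-points]
#9 SixExpIncidence (support) — incidence form of six exponentials (card T1): for ℚ-linearly
independent x₁..x_N and y₁..y_N, the bipartite graph {(i,j) : e^{xᵢyⱼ} ∈ ℚ̄} is K₂,₃-free (tree
theorem Literature.NumberTheory.Transcendental.six_exponentials_holds), hence has ≤ C·N^{3/2} edges
by the Kővári–Sós–Turán double count (Σ_j C(d_j,2) ≤ 2·C(N,2); C = 3 works). Rests on PROVED cone
facts only. [difficulty: provable-now] [Lang1966, Ramachandra1968, Jukna2011,
Literature.NumberTheory.Transcendental.six_exponentials_holds]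
#9 DilateIntersectionLemma (support) — the master lemma (card T2), CONDITIONAL on the inlined 2×3
"+x+y" clause of Thm 2.9 (= named fact Literature.Barriers.Schanuel.smallTrdeg_thm_2_9_pos,
t₂-clause at d=2, ℓ=3, `gridField₂` unfolded; inlined so the route's import cone stays
Mathlib-only): if trdeg_ℚ L ≤ 1, u ∈ L∖ℚ and y₁,y₂,y₃ ∈ L are ℚ-linearly independent with e^{yⱼ},
e^{u yⱼ} ∈ L, contradiction (x := (1,u) is independent, the grid field ℚ(x, y, e^{xᵢyⱼ}) sits inside
L, so 2 ≤ trdeg ≤ 1). Equivalently dim_ℚ(W ∩ uW) ≤ 2 for the exponential points W of L. ~150 lines.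
[difficulty: provable-now] [NesterenkoPhilippon2001, BakerTNT1975,
Literature.Barriers.Schanuel.smallTrdeg_thm_2_9_pos]
#9 PowerSpectrumSqrtBound (support) — (card B₁) under the same inlined 2×3 clause: for trdeg_ℚ L ≤ 1
and transcendental θ ∈ L, #{s ≤ N : e^{θ^s} ∈ L} ≤ 2⌊√N⌋ + 2. Proof: for k ≥ 1 the lemma with u =
θᵏ, y = (θ^{s₁}, θ^{s₂}, θ^{s₃}) shows each positive difference k is realised at most twice inside
the spectrum, so n(n−1)/2 ≤ 2N. "FG in density" for the power part of Γ(L), absolute constant. ~250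
lines over DilateIntersectionLemma. [difficulty: provable-now] [NesterenkoPhilippon2001, Jukna2011,
idea:Schanuel/Schanuel/dilate-intersection-exponential-points]
#9 HalfDensityBound (support) — (card B₀) under the same inlined 2×3 clause: for trdeg_ℚ L ≤ 1,
transcendental θ ∈ L and ℚ-linearly independent p₁..p_m ∈ ℚ[X] of degree ≤ D with e^{pᵢ(θ)} ∈ L: 2m
≤ D + 4. Proof: P := span pᵢ ⊂ ℚ[X]_{≤D}; dim(P ∩ X·P) ≥ 2m − (D+2); three independent X·qⱼ in P ∩
X·P give y = (qⱼ(θ)) violating the lemma in the relative algebraic closure of L (Mathlib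
`algebraicClosure ↥L ℂ`, same trdeg; e^{q(θ)} is algebraic over L for q in the ℚ-span). ~300 lines.
[difficulty: provable-now] [NesterenkoPhilippon2001, Diaz1989,
idea:Schanuel/Schanuel/dilate-intersection-exponential-points]
#9 LadderBookkeeping (support) — the ladder is ordered: X ⇒ PowerSpectrumAtMostOne ⇒
SubSqrtPowerSpectrum, and X ⇒ SubHalfDensity (the values pᵢ(θ) are ℚ-independent exponential points
of L). First conjunct kernel-checked in Sketch.lean (rank_imp_spectrum, axioms
propext/Classical.choice/Quot.sound). Certifies honestly that every crux is implied by the target (a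
ladder BELOW X). [difficulty: provable-now] [MantovaZannier2016,
idea:Schanuel/Schanuel/dilate-intersection-exponential-points]

TWO-LAYER PLAN. Foreseen glued splits (none filed now): PowerSpectrumAtMostOne ⇐ (s = 0 vs t ≥ 1: "e
∈ L excludes every e^{θ^t}",
the e-instances) → (1 ≤ s < t) → PowerSpectrumAtMostOne; SubSqrtPowerSpectrum ⇐ (inverse theorem: a
spectrum of size
≥ (2−ε)√N is Sidon-like / has small additive energy — pure additive combinatorics) → (no trdeg-1
field carries a
Sidon-like power spectrum of size ≫ 1 — the arithmetic closer, where new input is needed) →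
SubSqrtPowerSpectrum;
the trdeg-t versions (K_{t+1,·}-freeness via Diaz's Thm 2.7 under the Technical Hypothesis, shadow
N^{1−1/(t+1)})
as children of a later UniformRankBound-type item shared with ExpMordellWeil.

KILL CRITERIA. A pair s ≠ t with e^{θ^s}, e^{θ^t} in a trdeg-1 field (¬PowerSpectrumAtMostOne)
refutes Schanuel and closes every
route on the summit. A refuter's certificate that SubSqrtPowerSpectrum and SubHalfDensity are
EQUIVALENT to
PowerSpectrumAtMostOne (no density statement strictly between √N, ½ and 1 is easier) collapses the
ladder to one rung
⇒ close `superseded --by route-Schanuel-ExpMordellWeil` after the four supports land there as shared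
items. A support
refuted can only be a mis-formalisation (filter/coercion/`Nat.sqrt` constant): restate once with the
same decl name,
else drop. If the inlined 2×3 clause of Thm 2.9 were itself refuted (mis-rendering of
NesterenkoPhilippon2001 Ch.14
Thm 2.9), the three conditional supports become vacuous ⇒ restate them over the corrected clause.

NOT DECOMPOSED YET. The trdeg-t ≥ 2 density theorems (need `TechnicalHypothesis`/Thm 2.7 from the
Barriers file — kept out so the import
cone stays Mathlib-only; children later, with the named fact inlined); two-parameter spectra #{(a,b)
≤ N : e^{uᵃvᵇ} ∈
L} ≪ N^{3/2}; the ℚ-span/relative-algebraic-closure form of the lemma (dim_ℚ(W ∩ uW) ≤ 2 with W = ℚ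
⊗ Γ(L)) — the
prover of HalfDensityBound does this internally; the card's conditional (A)-tier (AlgIndepLogarithms
⇒ #E = O(N log N):
free-monoid reduction, owned by card pattern-exponentials-free-monoid, plus — planner's observation
— Harper's
hypercube edge-isoperimetric inequality, since pairs a + b = ±eᵢ are edges of the ℤ^∞-lattice graph
on A ∪ (−B) and
ℤ^∞ embeds isometrically in the cube: Θ(N log N), matching the Johnson-layer examples); the
inverse/stability
theorem for near-extremal multiplicity-2 difference sets (itself open combinatorics: even the B₂[2]
constant is
unknown); Brownawell–Waldschmidt's clause (smallTrdeg_thm_2_9_two_two: a row of two values algebraic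
over ℚ forbids
its translates in the spectrum) as an extra support. Prior-programme inspiration notes not read
(plancard mode).

CHEAPEST FALSIFIER. Lookup: is the density form already in print — "a field of transcendence degree
1 contains e^{θ^s} for O(√N) values
s ≤ N" or "at most O(N^{3/2}) of the N² numbers e^{xᵢyⱼ} are algebraic" — in Waldschmidt's
six-exponentials
variations (zbl:1176.11033, Hardy–Ramanujan J. 28 (2005)), Waldschmidt 2023
(doi:10.1007/978-3-031-12244-6_39), GL326
exercises, or Chudnovsky1984 Ch.1? (searched this session: not found; galaxy pdf/crabby stars were
saturated — a
refuter should re-run `lit galaxy search "six exponentials" --star pdf`). If found ⇒ supports graded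
known (still worth
vendoring), novelty drops to variant, route likely superseded by ExpMordellWeil. Logic check
(minutes): confirm no
grid shape (d,ℓ) with dℓ > d+ℓ fits inside a Sidon support or a generic half-dimensional P — done on
paper (card
calibration; planner re-derived: only (1,m) rows fit, and t₂ ≥ 2 needs dℓ > d+ℓ, impossible for d =
1).

NUMBERS. Shadows (card calibration, re-derived): K₂,₃ forbidden (theorem: six exponentials / Thm 2.9
2×3) ⇒ #E ≤ (1+√2)N^{3/2}
algebraic values and |S_θ ∩ [0,N]| ≤ 2√N + 2, rank ≤ D/2 + 2; K₂,₂ forbidden (four exponentials /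
Conj 2.3, OPEN) ⇒
still ≍ N^{3/2} and ≍ √N (Sidon sets: Erdős–Turán 1941 doi:10.1112/jlms/s1-16.4.212, |S| ≤ √N +
O(N^{1/4}), Bose–Chowla
constructions; Kővári–Sós–Turán: Jukna2011 Thm 2.4 p.37, Ex. 2.6 p.41); K₁,₂ forbidden = X at trdeg
1 ⇒ 1. Known instance counts on the e-power family
under T.H. (Chudnovsky1984 p.22): #alg.indep{e, e^e, …, e^{e⁷}} ≥ 3, {…, e^{e^{11}}} ≥ 4; Gel'fond
ladder ⌊(d+1)/2⌋
(Diaz1989). BakerTNT1975 Thm 12.2 (p.111): e^e, e^{e²} not both algebraic over ℚ — the only pair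
exclusions known are
of this absolute (over ℚ) kind; the relative pair "e, e^{π²} not both in ℚ̄(π)" is open (card
half-torsion-rung-e-exp-pi2).
Items at open: 10 (target, 3 cruxes, 5 supports, assembly); 2 of them (target, assembly) shared
verbatim with ExpMordellWeil.

DEFINITION REQUESTS. None. Γ(K), W = ℚ ⊗ Γ(L) and the spectra are inlined (IntermediateField
membership, Finset.filter over Finset.range,
Polynomial.aeval); the 2×3 clause of Thm 2.9 is inlined as a hypothesis rather than imported from
Literature.Barriers.Schanuel.LargeTranscendenceDegree (unproved named facts there would enter the
route's import cone).
A later definition `ExpPoints (K : IntermediateField ℚ ℂ) : Submodule ℚ ℂ` shared with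
ExpMordellWeil would shorten
every signature; not requested now.

Novelty: Searches (2026-08-15, this planner): `lit search --hybrid "six exponentials theorem number of
algebraic values exp(x_i y_j)
extremal graph Zarankiewicz"` (12 docs: BakerTNT1975 pp.110–112 READ — Thms 12.1–12.3, Tijdeman's
3×2/4×2 variants;
Baker1988 pp.298–300 READ — Roy–Waldschmidt strong six exponentials, no counting;
NesterenkoPhilippon2001 p.233/249;
extremal-combinatorics books separately: Bollobás, Jukna2011 §2.2 READ, Lo 2019 — no joint hit);
`lit vsearch` on the
incidence-count sentence (10 docs, same transcendence books + Chudnovsky1984 pp.19–22 READ: grid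
counts |Sᵢ|/(M+N) ≥ d,
'half of Schanuel', e-power family counts — trdeg growth on full grids, not density inside a fixed
field); `lit search
--source zbmath "six exponentials theorem"` (20: Waldschmidt's Variations 2005 zbl:1176.11033 /
zbl:1116.11054,
Waldschmidt 2023 doi:10.1007/978-3-031-12244-6_39, Roy1992, Pila 1993 zbl:0773.11046 (Pólya
postulation: points of
y = eˣ on curves — different count), Waldschmidt 'Integer valued entire functions on Cartesian
products' zbl:0941.11028
(integer values & growth, Pólya-type — different count)); `lit galaxy search "six exponentials
theorem" --star all`
(panama 12 generic textbook rows; pdf/crabby stars timed out twice — searched-but-not-exhaustive);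
`lit frontier Schanuel
--since 2020` (21 rows, none on counting algebraic values on product sets); `lit bridges Schanuel
--cross any`;
`ledger negatives --problem Schanuel` (0). Plus the card's and triage refuter's searches  [refs: 10.1007/978-3-031-12244-6_39, doi:10.1007/978-3-031-12244-6_39, BakerTNT1975, NesterenkoPhilippon2001, Jukna2011, Chudnovsky1984, Roy1992, MantovaZannier2016, Marker2006]

Barriers (technique_class: six-exponentials large-transcendence-degree combinatorics): - technique_class: six-exponentials large-transcendence-degree combinatorics
- Literature.Barriers.Schanuel.LargeTranscendenceDegree: NOT evaded — consumed and measured: the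
supports use exactly its printed T.H.-free output (smallTrdeg_thm_2_9_pos, 2×3 clause, inlined) and
the card's calibration turns its reach (dℓ > d+ℓ; Conj 2.3) into counting shadows (N^{3/2}, √N, ½);
the three cruxes are placed precisely beyond those shadows, so by construction this barrier's
technique class cannot close them; the bet is only that they are the cheapest well-posed targets for
any NEW input (scoreboard for cards tensor-mixed-gevrey-division, quadratic-logs-holonomy,
shift-difference-periods) and that the density theorems themselves are worth landing.
- Literature.Barriers.Schanuel.LinearSubgroupMethodLimit: same family ('the method cannot see this
configuration', roy1995_thm_3_4_holds); respected — Sidon/thin supports are added to its list of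
invisible configurations with a quantitative shadow; no claim to pass it.
- Literature.Barriers.Schanuel.AlgebraicIndependenceOfLogarithms: applies in full to the target X (⇒
AlgIndepLogarithms) and is accepted there; the cruxes at trdeg 1 with θ = log α touch only values
e^{(log α)^s} in ℚ̄(log α), i.e. polynomial (not linear) relations among logarithms — inside the
barrier's shadow for that slice, which is one more reason they are ranked open-problem; the supports
are degree-counting statements strictly below it.
- Literature.Barriers.Schanuel.Axioms

Novelty grade: new-combination — ROUTE REVIEW (refuter rreview-9955905d, 2026-08-15). 10/10 decls elaborate (probe rc0); 0 refuted; 0 vacuous. PROVED and attached: Assembly 3493 + LadderBookkeeping 5233 (DI_Proofs.lean) and DilateIntersectionLemma 5230 (DI_Lemma.lean, ~45 lines) — all rc0, 0 sorries, axioms {propext, Classical.choi (refuter refuter-rreview-route-ValiantsHypothesis-9955905d-0, 2026-08-15T14:00:04Z; prior: NesterenkoPhilippon2001 Ch.14 Thm 2.9 (tree: Literature.Barriers.Schanuel.two_le_trdeg_gridField₂); Literature.NumberTheory.Transcendental.six_exponentials_holds; Jukna2011 Thm 2.4 (Kővári–Sós–Turán); BakerTNT1975 Ch.12; route-Schanuel-ExpMordellWeil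 (shared target/assembly))

History (route lifecycle, newest last):
- 2026-08-16T04:17:02Z · AUTO-CRUX (backfill): RankLeTrdeg — hypotheses of the deciding theorem that nothing in the route derives are cruxes (operator:999:1085951)
- 2026-08-22T14:15:06Z · DORMANT — reconciler: no traction for 5.4 d (last activity item-evidence-added at 2026-08-17T04:13:05Z); parked, not closed — `ledger route dormant route-Schanuel-DilateI (operator:999:3331568)

sub-problem: Schanuel · status: dormant · opened planner-plancard-Schanuel-Schanuel-dilate-int-947c80f0-0 2026-08-15T11:40:23Z · rev 1 · ledger route-Schanuel-DilateIntersection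
GENERATED by the gate from the ledger (D-0016/17). Provers cite these decls: `theorem foo : Summit.Schanuel.Schanuel.Theses.DilateIntersection.<Decl> := …` in Summits/Schanuel/Schanuel/Theorems/<Name>.lean.
-/

namespace Summit.Schanuel.Schanuel.Theses.DilateIntersection

open scoped BigOperators Topology Manifold Classical MeasureTheory ProbabilityTheory Matrix InnerProductSpace ComplexConjugate ContinuousMap
open Filter Set Function TopologicalSpace MeasureTheory

attribute [summit_statement] _root_.Schanuel

open Literature.Periods

/-- item stmt-Schanuel-3486 · crux (kind.auto-crux: conjecture-grade) · rank 0 · open · by planner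
why it might fail: Iff Schanuel fails; at trdeg 1 it already contains e ⊥ π and e^{π²} ∉ ℚ̄(π); it is the K₁,₂ (one-row) statement no grid method sees.
sources: MantovaZannier2016, Marker2006, Waldschmidt2000, NesterenkoPhilippon2001
[target] X: for every subfield K ⊂ ℂ (no finiteness hypothesis needed) and every ℚ-linearly
independent u₁,…,uₙ ∈ Γ(K) = {u ∈ K : e^u ∈ K}, n ≤ trdeg_ℚ K ('Mordell–Weil rank of exp over K ≤
dimension of K'). ⟺ Schanuel (Assembly + SchanuelImpliesRankLeTrdeg). Card item C4. -/
@[route_item "route-Schanuel-DilateIntersection", crux]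
def RankLeTrdeg : Prop :=
  ∀ (K : IntermediateField ℚ ℂ) (n : ℕ) (u : Fin n → ℂ), (∀ i, u i ∈ K ∧ Complex.exp (u i) ∈ K) → LinearIndependent ℚ u → (n : Cardinal) ≤ Algebra.trdeg ℚ K

/-- item stmt-Schanuel-5226 · crux · rank 2 · open · by planner
why it might fail: False only with Schanuel n=2 on a power pair; as a rung it is K₁,₂ (one row, two exponentials in a trdeg-1 field): dℓ > d+ℓ fails for d = 1, so no grid theorem and not even Conj 2.3 / four exponentials reaches it — needs a relative Hermite–Lindemann nobody has.
sources: NesterenkoPhilippon2001, BakerTNT1975, Waldschmidt2004, Chudnovsky1984, idea:Schanuel/Schanuel/dilate-intersection-exponential-points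
[crux] Schanuel's value for power spectra (card X/T4): if L ⊂ ℂ has trdeg_ℚ L ≤ 1 and θ ∈ L is
transcendental, then e^{θ^s} ∈ L for at most one s ∈ ℕ. Instances: e^{e^s} ∉ ℚ̄(e) for all s ≥ 1
(none known); at most one of e, e^{π²}, e^{π³}, … lies in ℚ̄(π) (e^{π} excluded by Nesterenko);
structured slice of Schanuel n = 2 (pairs (θ^s, θ^t)). [difficulty: open-problem] -/
@[route_item "route-Schanuel-DilateIntersection"]
def PowerSpectrumAtMostOne : Prop :=
  ∀ (L : IntermediateField ℚ ℂ) (θ : ℂ), Algebra.trdeg ℚ L ≤ 1 → Transcendental ℚ θ → θ ∈ L → ∀ s t : ℕ, Complex.exp (θ ^ s) ∈ L → Complex.exp (θ ^ t) ∈ L → s = t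

/-- item stmt-Schanuel-5227 · crux · rank 3 · open · by planner
why it might fail: True under Schanuel; but Sidon sets have ≍√N elements and are K₂,₂-free, so even an in-field four-exponentials theorem leaves √N: any proof must extract trdeg 2 from ONE row (a K₁,ₘ configuration), which no transcendence method does — the statement may be exactly as hard as rank 2.
sources: NesterenkoPhilippon2001, Jukna2011, doi:10.1112/jlms/s1-16.4.212, idea:Schanuel/Schanuel/dilate-intersection-exponential-points
[crux] the detector (card C2): a uniform o(√N) bound for power spectra of transcendence-degree-one
fields — for every ε > 0 and N ≥ N₀(ε), every L with trdeg_ℚ L ≤ 1 and every transcendental θ ∈ L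
have #{s ≤ N : e^{θ^s} ∈ L} ≤ ε√N. Known: ≤ 2√N + 2 (support PowerSpectrumSqrtBound); Schanuel: ≤ 1.
[difficulty: open-problem] -/
@[route_item "route-Schanuel-DilateIntersection"]
def SubSqrtPowerSpectrum : Prop :=
  ∀ ε : ℝ, 0 < ε → ∃ N₀ : ℕ, ∀ N : ℕ, N₀ ≤ N → ∀ (L : IntermediateField ℚ ℂ) (θ : ℂ), Algebra.trdeg ℚ L ≤ 1 → Transcendental ℚ θ → θ ∈ L → (((Finset.range (N + 1)).filter (fun s => Complex.exp (θ ^ s) ∈ L)).card : ℝ) ≤ ε * Real.sqrt N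

/-- item stmt-Schanuel-5228 · crux · rank 4 · open · by planner
why it might fail: True under Schanuel; but a generic half-dimensional subspace P ⊂ ℚ[θ]_{≤D} meets none of its dilates θᵏP in dimension ≥ 3, so dilate/grid input ends exactly at ½ (cf. Diaz's ⌊(d+1)/2⌋ on Gel'fond's ladder, 35 years at 'half'); crossing ½ needs non-product information.
sources: NesterenkoPhilippon2001, Diaz1989, Chudnovsky1984, idea:Schanuel/Schanuel/grid-capacity-half-schanuel, idea:Schanuel/Schanuel/dilate-intersection-exponential-points
[crux] beat half density for polynomial exponents (card B₀ ↦ its first improvement): there are c <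
1/2 and C such that for every L with trdeg_ℚ L ≤ 1, transcendental θ ∈ L and ℚ-linearly independent
p₁,…,p_m ∈ ℚ[X] of degree ≤ D with all e^{pᵢ(θ)} ∈ L, m ≤ cD + C. Known: 2m ≤ D + 4 (support
HalfDensityBound); Schanuel: m ≤ 1. The density twin of the Gel'fond–Diaz "half" (AlgIndepMethod
crux GelfondDiazLadderFull). [difficulty: open-problem] -/
@[route_item "route-Schanuel-DilateIntersection"]
def SubHalfDensity : Prop :=
  ∃ c : ℝ, c < 1 / 2 ∧ ∃ C : ℝ, ∀ (L : IntermediateField ℚ ℂ) (θ : ℂ) (D m : ℕ) (p : Fin m → Polynomial ℚ), Algebra.trdeg ℚ L ≤ 1 → Transcendental ℚ θ → θ ∈ L → LinearIndependent ℚ p → (∀ i, (p i).natDegree ≤ D) → (∀ i, Complex.exp (Polynomial.aeval θ (p i)) ∈ L) → (m : ℝ) ≤ c * D + C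

/-- item stmt-Schanuel-5229 · support · rank 9 · open · by planner
sources: Lang1966, Ramachandra1968, Jukna2011, Literature.NumberTheory.Transcendental.six_exponentials_holds
[support] incidence form of six exponentials (card T1): for ℚ-linearly independent x₁..x_N and
y₁..y_N, the bipartite graph {(i,j) : e^{xᵢyⱼ} ∈ ℚ̄} is K₂,₃-free (tree theorem
Literature.NumberTheory.Transcendental.six_exponentials_holds), hence has ≤ C·N^{3/2} edges by the
Kővári–Sós–Turán double count (Σ_j C(d_j,2) ≤ 2·C(N,2); C = 3 works). Rests on PROVED cone facts
only. [difficulty: provable-now] -/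
@[route_item "route-Schanuel-DilateIntersection"]
def SixExpIncidence : Prop :=
  ∃ C : ℝ, ∀ (N : ℕ) (x y : Fin N → ℂ), LinearIndependent ℚ x → LinearIndependent ℚ y → (((Finset.univ : Finset (Fin N × Fin N)).filter (fun p => IsAlgebraic ℚ (Complex.exp (x p.1 * y p.2)))).card : ℝ) ≤ C * (N : ℝ) ^ ((3 : ℝ) / 2)

/-- item stmt-Schanuel-5230 · support · rank 9 · open · by planner
sources: NesterenkoPhilippon2001, BakerTNT1975, Literature.Barriers.Schanuel.smallTrdeg_thm_2_9_pos
[support] the master lemma (card T2), CONDITIONAL on the inlined 2×3 "+x+y" clause of Thm 2.9 (=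
named fact Literature.Barriers.Schanuel.smallTrdeg_thm_2_9_pos, t₂-clause at d=2, ℓ=3, `gridField₂`
unfolded; inlined so the route's import cone stays Mathlib-only): if trdeg_ℚ L ≤ 1, u ∈ L∖ℚ and
y₁,y₂,y₃ ∈ L are ℚ-linearly independent with e^{yⱼ}, e^{u yⱼ} ∈ L, contradiction (x := (1,u) is
independent, the grid field ℚ(x, y, e^{xᵢyⱼ}) sits inside L, so 2 ≤ trdeg ≤ 1). Equivalently dim_ℚ(W
∩ uW) ≤ 2 for the exponential points W of L. ~150 lines. [difficulty: provable-now] -/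
@[route_item "route-Schanuel-DilateIntersection"]
def DilateIntersectionLemma : Prop :=
  (∀ (x : Fin 2 → ℂ) (y : Fin 3 → ℂ), LinearIndependent ℚ x → LinearIndependent ℚ y → (2 : Cardinal) ≤ Algebra.trdeg ℚ ↥(IntermediateField.adjoin ℚ (Set.range x ∪ Set.range y ∪ Set.range (fun p : Fin 2 × Fin 3 => Complex.exp (x p.1 * y p.2))))) → ∀ (L : IntermediateField ℚ ℂ) (u : ℂ) (y : Fin 3 → ℂ), Algebra.trdeg ℚ L ≤ 1 → u ∈ L → u ∉ Set.range ((↑) : ℚ → ℂ) → LinearIndependent ℚ y → (∀ j, y j ∈ L ∧ Complex.exp (y j) ∈ L ∧ Complex.exp (u * y j) ∈ L) → False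

/-- item stmt-Schanuel-5231 · support · rank 9 · open · by planner
sources: NesterenkoPhilippon2001, Jukna2011, idea:Schanuel/Schanuel/dilate-intersection-exponential-points
[support] (card B₁) under the same inlined 2×3 clause: for trdeg_ℚ L ≤ 1 and transcendental θ ∈ L,
#{s ≤ N : e^{θ^s} ∈ L} ≤ 2⌊√N⌋ + 2. Proof: for k ≥ 1 the lemma with u = θᵏ, y = (θ^{s₁}, θ^{s₂},
θ^{s₃}) shows each positive difference k is realised at most twice inside the spectrum, so n(n−1)/2
≤ 2N. "FG in density" for the power part of Γ(L), absolute constant. ~250 lines over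
DilateIntersectionLemma. [difficulty: provable-now] -/
@[route_item "route-Schanuel-DilateIntersection"]
def PowerSpectrumSqrtBound : Prop :=
  (∀ (x : Fin 2 → ℂ) (y : Fin 3 → ℂ), LinearIndependent ℚ x → LinearIndependent ℚ y → (2 : Cardinal) ≤ Algebra.trdeg ℚ ↥(IntermediateField.adjoin ℚ (Set.range x ∪ Set.range y ∪ Set.range (fun p : Fin 2 × Fin 3 => Complex.exp (x p.1 * y p.2))))) → ∀ (L : IntermediateField ℚ ℂ) (θ : ℂ) (N : ℕ), Algebra.trdeg ℚ L ≤ 1 → Transcendental ℚ θ → θ ∈ L → ((Finset.range (N + 1)).filter (fun s => Complex.exp (θ ^ s) ∈ L)).card ≤ 2 * Nat.sqrt N + 2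

/-- item stmt-Schanuel-5232 · support · rank 9 · open · by planner
sources: NesterenkoPhilippon2001, Diaz1989, idea:Schanuel/Schanuel/dilate-intersection-exponential-points
[support] (card B₀) under the same inlined 2×3 clause: for trdeg_ℚ L ≤ 1, transcendental θ ∈ L and
ℚ-linearly independent p₁..p_m ∈ ℚ[X] of degree ≤ D with e^{pᵢ(θ)} ∈ L: 2m ≤ D + 4. Proof: P := span
pᵢ ⊂ ℚ[X]_{≤D}; dim(P ∩ X·P) ≥ 2m − (D+2); three independent X·qⱼ in P ∩ X·P give y = (qⱼ(θ))
violating the lemma in the relative algebraic closure of L (Mathlib `algebraicClosure ↥L ℂ`, same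
trdeg; e^{q(θ)} is algebraic over L for q in the ℚ-span). ~300 lines. [difficulty: provable-now] -/
@[route_item "route-Schanuel-DilateIntersection"]
def HalfDensityBound : Prop :=
  (∀ (x : Fin 2 → ℂ) (y : Fin 3 → ℂ), LinearIndependent ℚ x → LinearIndependent ℚ y → (2 : Cardinal) ≤ Algebra.trdeg ℚ ↥(IntermediateField.adjoin ℚ (Set.range x ∪ Set.range y ∪ Set.range (fun p : Fin 2 × Fin 3 => Complex.exp (x p.1 * y p.2))))) → ∀ (L : IntermediateField ℚ ℂ) (θ : ℂ) (D m : ℕ) (p : Fin m → Polynomial ℚ), Algebra.trdeg ℚ L ≤ 1 → Transcendental ℚ θ → θ ∈ L → LinearIndependent ℚ p → (∀ i, (p i).natDegree ≤ D) → (∀ i, Complex.exp (Polynomial.aeval θ (p i)) ∈ L) → 2 * m ≤ D + 4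

/-- item stmt-Schanuel-5233 · support · rank 9 · open · by planner
sources: MantovaZannier2016, idea:Schanuel/Schanuel/dilate-intersection-exponential-points
[support] the ladder is ordered: X ⇒ PowerSpectrumAtMostOne ⇒ SubSqrtPowerSpectrum, and X ⇒
SubHalfDensity (the values pᵢ(θ) are ℚ-independent exponential points of L). First conjunct
kernel-checked in Sketch.lean (rank_imp_spectrum, axioms propext/Classical.choice/Quot.sound).
Certifies honestly that every crux is implied by the target (a ladder BELOW X). [difficulty:
provable-now] -/
@[route_item "route-Schanuel-DilateIntersection"]
def LadderBookkeeping : Prop :=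
  (RankLeTrdeg → PowerSpectrumAtMostOne) ∧ (PowerSpectrumAtMostOne → SubSqrtPowerSpectrum) ∧ (RankLeTrdeg → SubHalfDensity)

/-- item stmt-Schanuel-3493 · assembly · rank 1 · open · by planner
sources: Waldschmidt2000, MantovaZannier2016
[assembly] X → Schanuel: given z : Fin n → ℂ ℚ-linearly independent take K :=
IntermediateField.adjoin ℚ (Set.range z ∪ Set.range (Complex.exp ∘ z)) and u := z (membership by
IntermediateField.subset_adjoin); X gives (n : Cardinal) ≤ Algebra.trdeg ℚ K, which is
Literature.Periods.SchanuelConjecture unfolded. Kernel-checked in the planner sketch (Sketch.lean,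
assembly_holds; axioms propext, Classical.choice, Quot.sound). Staffable now. [difficulty:
provable-now] -/
@[route_item "route-Schanuel-DilateIntersection"]
def Assembly : Prop :=
  RankLeTrdeg → Schanuel

/-! D-0027 §2.1 — DECIDING THEOREM (planner-authored via `route open/edit --closes-file`; by planner-rbadge-Schanuel-DilateIntersection-03c3bcd6-g2-0 2026-08-15T16:10:42Z):
its hypotheses are this route's items and its conclusion the sub-problem Statement (glue_lint), and it elaborates with this file. -/

/-- D-0027 §2.1 deciding theorem of route DilateIntersection: hypothesis = the route's target item
`RankLeTrdeg` (X: the ℚ-linearly independent exponential points `u ∈ K, e^u ∈ K` of any subfield `K ⊂ ℂ`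
number at most `trdeg_ℚ K`), conclusion = the sub-problem Statement `Schanuel` BY NAME. Proof (the route's
Assembly bookkeeping, now kernel-checked here): for `z : Fin n → ℂ` ℚ-linearly independent apply X to
`K := IntermediateField.adjoin ℚ (range z ∪ range (exp ∘ z))` and `u := z` (memberships by
`IntermediateField.subset_adjoin`); the inequality X returns is `Literature.Periods.SchanuelConjecture` at `(n, z)`
verbatim. The ranked cruxes (PowerSpectrumAtMostOne, SubSqrtPowerSpectrum, SubHalfDensity) are rungs strictly
BELOW X (ladder route: `LadderBookkeeping` records X ⇒ each of them) and are deliberately not hypotheses of `closes`. -/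
@[closes "route-Schanuel-DilateIntersection"] theorem closes (hX : RankLeTrdeg) : _root_.Schanuel := by
  intro n z hz
  refine hX _ n z (fun i => ⟨?_, ?_⟩) hz
  · exact IntermediateField.subset_adjoin ℚ _ (Or.inl ⟨i, rfl⟩)
  · exact IntermediateField.subset_adjoin ℚ _ (Or.inr ⟨i, rfl⟩)

end Summit.Schanuel.Schanuel.Theses.DilateIntersection
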